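import Summits.NavierStokesRegularity.NavierStokesRegularity.Theses.SymmetryModuliCount
import Literature.Analysis.FluidPDE.TypeIAncientMild
import Literature.Analysis.FluidPDE.LocalTypeI
import Literature.Analysis.FluidPDE.SpaceTimeRescaling
import Summits.NavierStokesRegularity.NavierStokesRegularity.Theorems.SymmetryModuliCountAxisymEndLiouvilleOfFarPastLedgerAssembly
import Summits.NavierStokesRegularity.NavierStokesRegularity.Theorems.SymmetryModuliCountAxisymEndLiouvilleOfFarPastLedgerPressure
import Summits.NavierStokesRegularity.NavierStokesRegularity.Theorems.SymmetryModuliCountAxisymEndLiouvilleOfFarPastLedgerCubic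
import Summits.NavierStokesRegularity.NavierStokesRegularity.Theorems.SymmetryModuliCountFarPastLedgerCovering
import Summits.NavierStokesRegularity.NavierStokesRegularity.Theorems.SymmetryModuliCountFarPastLedgerFarShell
import Summits.NavierStokesRegularity.NavierStokesRegularity.Theorems.SymmetryModuliCountFarPastLedgerPressureGradientBound
import Summits.NavierStokesRegularity.NavierStokesRegularity.Theorems.SymmetryModuliCountFarPastLedgerPinning
import Summits.NavierStokesRegularity.NavierStokesRegularity.Theorems.SymmetryModuliCountFarPastLedgerMeanDisplacement
import Summits.NavierStokesRegularity.NavierStokesRegularity.Theorems.SymmetryModuliCountForcedSymmetryFutureVertexLiouvilleIrrotational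
import Summits.NavierStokesRegularity.NavierStokesRegularity.Theorems.SymmetryModuliCountHelicalEndLiouvilleForwardVanishing
import Summits.NavierStokesRegularity.NavierStokesRegularity.Theorems.SymmetryModuliCountForcedSymmetryStubBlowDownDriver
import Summits.NavierStokesRegularity.NavierStokesRegularity.Theorems.SymmetryModuliCountForcedSymmetrySelfSimilarVertexLeaf
import Summits.NavierStokesRegularity.NavierStokesRegularity.Theorems.SymmetryModuliCountFarPastLedger
import HarnessLib.Audit

/-!
# Skeleton line `blow-down-census` for crux `ForcedSymmetry` (stmt-NavierStokesRegularity-4052) — gen 3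

Gen 3 (lead `prover-line-stmt-NavierStokesRegularity-4052-c2`, 2026-08-16): c1's gen-2 skeleton with the two external
known-type stubs DISCHARGED FROM THE TREE — `stub_farPastLedger := Theorems.FarPastLedger_proof` and
`stub_slicePressureHA := Theorems.stub_fplSlicePressure` (both `Theorems/SymmetryModuliCountFarPastLedger.lean`, landed
13:11Z by the stmt-14060 lead) — so the file has exactly ONE `sorry`, the X-strength stub `stub_blowDownLimitSelfSimilar`
(kernel-checked ⇔ X ⇔ ForcedSymmetry: `Theorems/SymmetryModuliCountForcedSymmetryAsymptoticallySelfSimilar.lean` +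
the lead-c2 residual file `Theorems/SymmetryModuliCountForcedSymmetryBlowDownResidual.lean`).  Text below is c1's.

Route `SymmetryModuliCount`, sub-problem `NavierStokesRegularity`. Lead `prover-line-stmt-NavierStokesRegularity-4052-c1`
(2026-08-16), RESHAPE of the planner's checked skeleton (`Lines/blow-down-census.lean`, gen 1, 4 stubs) into the
currency of the tree's 𝒦-route chain (`Theorems/SymmetryModuliCountAxisymEndLiouvilleOfFarPastLedger*`), so that
every known-type step is a LANDED theorem or a short adaptation of one.

## The line (unchanged idea)

`ForcedSymmetry ⇔ X := TypeIAncientLiouville` (panel finding; `Disproof.lean §4`; with the Killing leaves 14061/14062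
now proved the equivalence is unconditional, `Theorems/SymmetryModuliCountForcedSymmetryCollapse.lean`), so the line
proves `A_C = {0}` by BLOW-DOWN and takes the symmetry of the zero field:
1. LEDGER (`stub_farPastLedger` = route item `FarPastLedger`, stmt-14060, its own crux chain): Leray-rate energy
   `∫_{B_R(x₀)} |u(t)|² ≤ K(C) R` on every ball.
2. PRESSURE (`stub_slicePressureHA` = verbatim the registered stub `stub_fplSlicePressure` of crux 14060's line
   `uloc-gronwall-transplant`): slice harmonic analysis of the Oseen pressure; with the LANDED `stub_fplPressureGradientBound`,
   `stub_fplPinning`, `stub_fplMeanDisplacement` it gives the near/far window pressure of every element of `A_C`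
   (`nearFar_window_of_parts`), and with the LANDED `stub_fplFarShell`/`stub_fplCovering` the pressure package
   (`pressurePackage_of_nearFar`): every backward shift of an element of `A_C ∩ 𝒦_K` is a suitable weak solution in
   the unit parabolic ball with `‖q‖_{3/2} ≤ D₀(C,K)` — i.e. `A_C ∩ {Leray rate} ⊂ 𝒦` (the planner's stub 2).
3. DRIVER (`stub_blowDownDriver`, known type, M: the landed axisymmetric driver `exists_singular_axisymmetric_limit`
   with the symmetry transport deleted and the C_loc-limit in `A_C` added): if `u(t₀,x₀) ≠ 0`, the blow-downs
   `c_k u(t₁ + c_k² s, x₁ + c_k y)`, `c_k → ∞`, have along one subsequence BOTH an `L³_loc` suitable weak limit `U`,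
   SINGULAR at the origin (`SuitableCompactness_holds` + `PersistenceOfSingularities_holds`, A–B Lemma 2.2 / Prop 2.3,
   PROVED), AND a slice-wise pointwise/locally-uniform limit `W ∈ A_C` (`exists_tendsto_of_isTypeIAncientMild_seq`,
   PROVED), with `U = W` a.e. on `Q(0,½)`.
4. THE BET (`stub_blowDownLimitSelfSimilar`, X-strength, hardest, lead): the smooth blow-down limit `W` is backward
   SELF-SIMILAR about the origin, `y·∇W + W + 2s ∂ₛW ≡ 0` (Giga–Kohn form of `UniqueBlowDown`).
5. VERTEX LEAF (glue, sorry-free, from LANDED theorems): a self-similar element of `A_C` about `(0,0)` vanishes —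
   shift back by one (`IsTypeIAncientMild.comp_sub_right`), apply the previous lead's future-vertex soliton Liouville
   `stub_futureVertexLiouvilleIrrotational` (Tsai 1998 Thm 1, `q = ∞`, + the Oseen gauge), then
   `symmetryModuliCount_backwardEndVanishing_proof` (item 14064, PROVED).
Then `U = 0` a.e. on `Q(0,½)`, contradicting the singularity: `u ≡ 0`, i.e. X (`typeIAncientLiouville_of_line`),
and `ForcedSymmetry_of` concludes the crux BY NAME.

## Registered stubs (4; ≤ stubs_max) — status after cycle 1 (lead c1)

`stub_farPastLedger` (= stmt-14060; gen 3: DISCHARGED, `FarPastLedger_proof`) · `stub_slicePressureHA` (= 14060's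
`stub_fplSlicePressure`; gen 3: DISCHARGED) · `stub_blowDownDriver` (LANDED p96980, `Theorems/SymmetryModuliCountForcedSymmetryStubBlowDownDriver.lean`)
· `stub_blowDownLimitSelfSimilar` (X-strength, OPEN — hardest; ⇔ X given the other three, see the reduction file).
Landed with the line (all `--supports stmt-4052`): the vertex leaf `selfSimilarOriginVertex_vanishes` (p98310,
`…ForcedSymmetrySelfSimilarVertexLeaf.lean`), the ε-regularity Liouville in the perturbative-ledger regime
`ForcedSymmetry.BlowDownCensus.smallLedger_liouville_of_parts` (p100535, `…ForcedSymmetrySmallLedgerLiouville.lean`: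
`2CK + D₀ ≤ ε ⇒ A_C ∩ 𝒦_K = {0}` — any counterexample to X has Leray-rate energy above a universal threshold on some
ball), and the importable REDUCTION `typeIAncientLiouville_of_ledger_slicePressure_selfSimilarBlowDown` /
`forcedSymmetry_of_ledger_slicePressure_selfSimilarBlowDown` (p101936, `…ForcedSymmetryBlowDownReduction.lean`:
this file's composition with the three open stubs as hypotheses).

## Disproof used

`Cruxes/ForcedSymmetry/Disproof.lean` v9 (read 2026-08-16): `forcedSymmetry_false_without_H3` /
`not_forcedSymmetryOnDriftClass` honoured — H3 enters stubs 1–3 (local energy identity with the NS pressure;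
suitability; persistence is a statement about NS suitable weak solutions) and the vertex leaf (Oseen gauge);
§2/§5 (`C ≤ 0`, `C ≤ ε`: `A_C = {0}`) consistent — the contradiction branch is never entered; §4
`forcedSymmetry_of_typeIAncientLiouville` is the last step (re-proved as `simSymmetry_of_vanishes`); §10 (λ-DSS does
not force symmetry kinematically) is exactly why stub 4 is X-strength: a λ-DSS element of `A_C ∩ 𝒦` would be its own
blow-down limit and is not self-similar. No `-- Targets` entry kills a stub of this line (the §8 targets are the
time-anchor stubs). Negatives index: 4055 (drift-class linear count) not touched — every stub quantifies over `A_C`.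
-/

noncomputable section

set_option linter.dupNamespace false

open MeasureTheory Set Function Filter Topology TopologicalSpace Metric
open scoped NNReal ENNReal InnerProductSpace
open Literature.Analysis.FluidPDE
open Summit.NavierStokesRegularity.NavierStokesRegularity.Theses.SymmetryModuliCount
open Summit.NavierStokesRegularity.NavierStokesRegularity.Theorems
open Summit.NavierStokesRegularity.NavierStokesRegularity.Theorems.AxisymEndLiouvilleOfFarPastLedger

namespace Summit.NavierStokesRegularity.NavierStokesRegularity.Cruxes.ForcedSymmetry.BlowDownCensus

/-! ## The four registered stubs -/

/-- **Stub 1 — the far-past energy LEDGER at Leray's rate** = route item `FarPastLedger`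
(stmt-NavierStokesRegularity-14060, crux, its own line `uloc-gronwall-transplant`): for every `C` there is `K = K(C)`
with `∫_{B_R(x₀)} ‖u(t)‖² ≤ K R` for all `u ∈ A_C`, `t < 0`, `x₀`, `R > 0`. Closed by name when that item lands. -/
theorem stub_farPastLedger : FarPastLedger :=
  Summit.NavierStokesRegularity.NavierStokesRegularity.Theorems.FarPastLedger_proof

/-- **Stub 2 — slice harmonic analysis of the Oseen pressure (HA)**, VERBATIM the registered stub
`stub_fplSlicePressure` of crux stmt-14060's line `uloc-gronwall-transplant` (nine helper files landed by that lead,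
`Theorems/SymmetryModuliCountFarPastLedgerSlice*`): any smooth `q` with `Δq = −∂ᵢ∂ⱼ(wᵢwⱼ)`, `∇q` bounded, `w` smooth
bounded divergence free, splits on every `B₂(x₀)` as `c + ⟪a,x⟫ + p₁ + p₂` with `‖p₁‖₂² ≤ c₀M²∫_{B₄(x₀)}‖w‖²`,
`‖∇p₂‖ ≤ c₀∫_{|y−x₀|≥3}‖w‖²|y−x₀|⁻⁴`, the affine mode `a` being the large-scale average of `∇q`. KNSS 2009 §2–§4. -/
theorem stub_slicePressureHA :
    ∃ c₀ : ℝ, 0 ≤ c₀ ∧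
    ∀ (M L : ℝ) (w : EuclideanSpace ℝ (Fin 3) → EuclideanSpace ℝ (Fin 3))
      (q : EuclideanSpace ℝ (Fin 3) → ℝ),
    ContDiff ℝ (⊤ : ℕ∞) w → ContDiff ℝ (⊤ : ℕ∞) q →
    Literature.Analysis.FluidPDE.VectorCalculus.IsDivFree w →
    (∀ x, ‖w x‖ ≤ M) → (∀ x, ‖fderiv ℝ q x‖ ≤ L) →
    (∀ x, Laplacian.laplacian q x =
      -Literature.Analysis.FluidPDE.VectorCalculus.divergence
        (Literature.Analysis.FluidPDE.convect w w) x) →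
    ∃ a : EuclideanSpace ℝ (Fin 3),
      (∀ x₀ : EuclideanSpace ℝ (Fin 3), ∃ (c : ℝ) (p₁ p₂ : EuclideanSpace ℝ (Fin 3) → ℝ),
        (∀ x ∈ Metric.ball x₀ 2, q x = c + inner ℝ a x + p₁ x + p₂ x) ∧
        MeasureTheory.MemLp p₁ 2 MeasureTheory.volume ∧
        ∫ x, p₁ x ^ 2 ≤ c₀ * M ^ 2 * ∫ x in Metric.ball x₀ 4, ‖w x‖ ^ 2 ∧
        ∀ x ∈ Metric.ball x₀ 2, DifferentiableAt ℝ p₂ x ∧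
          ‖fderiv ℝ p₂ x‖ ≤ c₀ * ∫ y in (Metric.ball x₀ 3)ᶜ, ‖w y‖ ^ 2 / ‖y - x₀‖ ^ 4) ∧
      ∀ r : ℝ, 1 ≤ r →
        ‖(∫ x, ((⟨1, 2, zero_lt_one, one_lt_two⟩ : ContDiffBump (0 : EuclideanSpace ℝ (Fin 3))) :
              EuclideanSpace ℝ (Fin 3) → ℝ) (r⁻¹ • x))⁻¹ •
            (∫ x, (((⟨1, 2, zero_lt_one, one_lt_two⟩ :
                ContDiffBump (0 : EuclideanSpace ℝ (Fin 3))) : EuclideanSpace ℝ (Fin 3) → ℝ)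
                  (r⁻¹ • x)) • gradient q x) - a‖ ≤ c₀ * M ^ 2 / r :=
  Summit.NavierStokesRegularity.NavierStokesRegularity.Theorems.stub_fplSlicePressure

/-- **Stub 3 — the general blow-down DRIVER** (LANDED p96980 as
`Theorems/SymmetryModuliCountForcedSymmetryStubBlowDownDriver.lean`; known type, M; the landed
`AxisymEndLiouvilleOfFarPastLedger.exists_singular_axisymmetric_limit` with the symmetry transport deleted and the
`A_C`-limit added). Inputs: the uniform cubic bound and the pressure package for the class `A_C ∩ {ledger K}`
(hypotheses, discharged in the composition by `lintegral_parabolicCylinder_le` and `pressurePackage_of_nearFar`),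
an element `v` with ledger `K` and `v(t₀,x₀) ≠ 0`, `t₀ < 0`. Output: a centre `(t₁,x₁)`, `t₁ < 0`, scales
`c_k > 0`, `c_k → ∞` (already passed to the subsequence), the `L³_loc` suitable weak limit `U` of the blow-downs
`c_k v(t₁ + c_k² s, x₁ + c_k y)` in `Q(0,1)` — SINGULAR at the origin by `SuitableCompactness_holds` +
`PersistenceOfSingularities_holds` (A–B Lemma 2.2, Prop 2.3) fed by `tendsto_eLpNorm_top_zoom_atTop` — and their
slice-wise pointwise and locally uniform limit `W ∈ A_C` (`exists_tendsto_of_isTypeIAncientMild_seq` applied to the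
blow-downs, which lie in `A_C` by `isTypeIAncientMild_zoom` + `comp_sub_right`), identified with `U` a.e. on `Q(0,½)`
(an a.e.-convergent subsequence of the `L³` convergence). [AlbrittonBarker2019 Lemma 2.2, Prop 2.3, §3] -/
theorem stub_blowDownDriver :
    ∀ (C K D₀ : ℝ),
    (∀ w : ℝ → EuclideanSpace ℝ (Fin 3) → EuclideanSpace ℝ (Fin 3), IsTypeIAncientMild C w →
      (∀ t < 0, ∀ (x₀ : EuclideanSpace ℝ (Fin 3)) (R : ℝ), 0 < R →
        ∫ x in ball x₀ R, ‖w t x‖ ^ 2 ≤ K * R) →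
      ∫⁻ z in parabolicCylinder 1 (0 : ℝ × EuclideanSpace ℝ (Fin 3)), ‖w z.1 z.2‖ₑ ^ (3 : ℕ) ≤
        ENNReal.ofReal (2 * C * K)) →
    (∀ w : ℝ → EuclideanSpace ℝ (Fin 3) → EuclideanSpace ℝ (Fin 3), IsTypeIAncientMild C w →
      (∀ t < 0, ∀ (x₀ : EuclideanSpace ℝ (Fin 3)) (R : ℝ), 0 < R →
        ∫ x in ball x₀ R, ‖w t x‖ ^ 2 ≤ K * R) →
      ∀ T ∈ Ioc (0 : ℝ) 1, ∃ q : ℝ → EuclideanSpace ℝ (Fin 3) → ℝ,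
        IsSuitableWeakSolutionInBall 1 0 (fun s y => w (s - T) y) q ∧
        ∫⁻ z in parabolicCylinder 1 (0 : ℝ × EuclideanSpace ℝ (Fin 3)), ‖q z.1 z.2‖ₑ ^ (3 / 2 : ℝ) ≤
          ENNReal.ofReal D₀) →
    ∀ (v : ℝ → EuclideanSpace ℝ (Fin 3) → EuclideanSpace ℝ (Fin 3)), IsTypeIAncientMild C v →
      (∀ t < 0, ∀ (x₀ : EuclideanSpace ℝ (Fin 3)) (R : ℝ), 0 < R →
        ∫ x in ball x₀ R, ‖v t x‖ ^ 2 ≤ K * R) →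
      ∀ (t₀ : ℝ) (x₀ : EuclideanSpace ℝ (Fin 3)), t₀ < 0 → v t₀ x₀ ≠ 0 →
      ∃ (t₁ : ℝ) (x₁ : EuclideanSpace ℝ (Fin 3)) (c : ℕ → ℝ)
        (U W : ℝ → EuclideanSpace ℝ (Fin 3) → EuclideanSpace ℝ (Fin 3)),
        t₁ < 0 ∧ (∀ k, 0 < c k) ∧ Tendsto c atTop atTop ∧ IsTypeIAncientMild C W ∧
        (∀ s < 0, ∀ y, Tendsto (fun k => c k • v (t₁ + c k ^ 2 * s) (x₁ + c k • y)) atTop (𝓝 (W s y))) ∧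
        (∀ s < 0, TendstoLocallyUniformly
          (fun k (y : EuclideanSpace ℝ (Fin 3)) => c k • v (t₁ + c k ^ 2 * s) (x₁ + c k • y)) (W s) atTop) ∧
        IsBackwardSingularPoint U 0 ∧
        uncurry U =ᵐ[volume.restrict (parabolicCylinder (1 / 2) (0 : ℝ × EuclideanSpace ℝ (Fin 3)))]
          uncurry W :=
  Summit.NavierStokesRegularity.NavierStokesRegularity.Theorems.ForcedSymmetry.BlowDownCensus.stub_blowDownDriver

/-- **Stub 4 — BLOW-DOWN LIMITS ARE SELF-SIMILAR (X-strength; the bet of the line; hardest; lead).** For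
`v ∈ A_C` with the Leray-rate ledger `K`, any centre `(t₁, x₁)` with `t₁ < 0`, any scales `c_k > 0`, `c_k → ∞`,
every slice-wise (pointwise and locally uniform) limit `W ∈ A_C` of the blow-downs `c_k v(t₁ + c_k² s, x₁ + c_k y)`
is BACKWARD SELF-SIMILAR about the space–time origin: `y·∇W + W + 2s ∂ₛW ≡ 0` on `s < 0`. The Navier–Stokes
analogue of Giga–Kohn 1985 (Type-I blow-up of `u_t = Δu + |u|^{p−1}u` is asymptotically self-similar, via the
monotone weighted energy in similarity variables) and of Huisken's tangent-flow theorem; the load-bearing consequence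
of the card's `UniqueBlowDown`. OPEN: no monotone / Łojasiewicz quantity for the Leray-similarity flow on `A_C ∩ 𝒦` is
known — that quantity is what a proof must supply. Vacuous if X holds; refuted exactly by the route's kill criteria
(a nonzero λ-DSS or rotated-self-similar Type-I profile in `A_C ∩ 𝒦` is its own blow-down limit modulo phases and is
not self-similar: BradshawTsai2017CPDE OP 5.1, PineauVicol2026 Conj. 1.1). [GigaKohn1985; Huisken1990;
PineauVicol2026 Thm 1.9 (quantitative foothold); Chae2007 Thm 1.5 (forward pattern)] -/
theorem stub_blowDownLimitSelfSimilar :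
    ∀ (C K : ℝ) (v : ℝ → EuclideanSpace ℝ (Fin 3) → EuclideanSpace ℝ (Fin 3)), IsTypeIAncientMild C v →
      (∀ t < 0, ∀ (x₀ : EuclideanSpace ℝ (Fin 3)) (R : ℝ), 0 < R →
        ∫ x in ball x₀ R, ‖v t x‖ ^ 2 ≤ K * R) →
      ∀ (t₁ : ℝ) (x₁ : EuclideanSpace ℝ (Fin 3)), t₁ < 0 →
      ∀ (c : ℕ → ℝ), (∀ k, 0 < c k) → Tendsto c atTop atTop →
      ∀ (W : ℝ → EuclideanSpace ℝ (Fin 3) → EuclideanSpace ℝ (Fin 3)), IsTypeIAncientMild C W →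
        (∀ s < 0, ∀ y, Tendsto (fun k => c k • v (t₁ + c k ^ 2 * s) (x₁ + c k • y)) atTop (𝓝 (W s y))) →
        (∀ s < 0, TendstoLocallyUniformly
          (fun k (y : EuclideanSpace ℝ (Fin 3)) => c k • v (t₁ + c k ^ 2 * s) (x₁ + c k • y)) (W s) atTop) →
        ∀ s < 0, ∀ y, fderiv ℝ (W s) y y + W s y + (2 * s) • timeDeriv W s y = 0 := by
  sorry

/-! ## Glue (sorry-free) -/

/-- **The vertex leaf**: an element of `A_C` which is backward self-similar about the space–time origin vanishes.
Shift back by one: `t ↦ W(t − 1)` lies in `A_C` (`IsTypeIAncientMild.comp_sub_right`) and is annihilated by the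
scaling generator about the FUTURE vertex `(1, 0)`, so the landed future-vertex soliton Liouville theorem
`stub_futureVertexLiouvilleIrrotational` (Euler homogeneity ⇒ bounded Leray profile ⇒ constant by Tsai 1998 Thm 1
⇒ `0` in the Oseen gauge) kills it on `t < 0`, i.e. `W ≡ 0` on `t < −1`; the landed route item
`BackwardEndVanishing` (`symmetryModuliCount_backwardEndVanishing_proof`) propagates the vanishing to `t < 0`.
LANDED (p98310) as `Theorems.selfSimilarOriginVertex_vanishes`
(`Theorems/SymmetryModuliCountForcedSymmetrySelfSimilarVertexLeaf.lean`). -/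
theorem selfSimilar_vanishes {C : ℝ} {W : ℝ → EuclideanSpace ℝ (Fin 3) → EuclideanSpace ℝ (Fin 3)}
    (hW : IsTypeIAncientMild C W)
    (hss : ∀ s < 0, ∀ y, fderiv ℝ (W s) y y + W s y + (2 * s) • timeDeriv W s y = 0) :
    ∀ s < 0, ∀ y, W s y = 0 :=
  selfSimilarOriginVertex_vanishes C W hW hss

/-- A field vanishing on `t < 0` has the (translation) symmetry `ξ = (e₀, 0, 0)` — the literal conclusion of the
crux (`Disproof.lean §2`, `hasSimSymmetry_of_vanishes`; `§4 forcedSymmetry_of_typeIAncientLiouville`). -/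
theorem simSymmetry_of_vanishes {u : ℝ → EuclideanSpace ℝ (Fin 3) → EuclideanSpace ℝ (Fin 3)}
    (h : ∀ t < 0, ∀ x, u t x = 0) :
    ∃ (a : EuclideanSpace ℝ (Fin 3)) (σ : ℝ) (A : EuclideanSpace ℝ (Fin 3) →L[ℝ] EuclideanSpace ℝ (Fin 3)),
      (∀ x, inner ℝ (A x) x = 0) ∧ ¬ (a = 0 ∧ σ = 0 ∧ A = 0) ∧
      ∀ t < 0, ∀ x, fderiv ℝ (u t) x (a + σ • x + A x) + σ • u t x +
        (2 * σ * t) • timeDeriv u t x - A (u t x) = 0 := by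
  refine ⟨EuclideanSpace.single 0 1, 0, 0, fun x => by simp, fun hh => ?_, fun t ht x => ?_⟩
  · have h1 : (EuclideanSpace.single (0 : Fin 3) (1 : ℝ) : EuclideanSpace ℝ (Fin 3)) 0 = 1 := by simp
    rw [hh.1] at h1
    simp at h1
  · have hut : u t = fun _ => 0 := funext (h t ht)
    simp [hut]

/-! ## The composition (sorry-free) -/

/-- **The line proves the route target `X = TypeIAncientLiouville` (stmt-4050)** from the four stubs and the tree:
ledger (stub 1) ⇒ near/far window pressure (stub 2 + landed GRADP/PIN/MD via `nearFar_window_of_parts`) ⇒ pressure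
package (`pressurePackage_of_nearFar` + landed SHELL/COV) and cubic bound (`lintegral_parabolicCylinder_le`) ⇒
blow-down at a point where `u ≠ 0` (stub 3): singular `L³` limit `U` = smooth limit `W ∈ A_C` a.e. ⇒ `W`
self-similar (stub 4) ⇒ `W ≡ 0` (vertex leaf) ⇒ `U = 0` a.e. on `Q(0,½)`, not singular: contradiction. -/
theorem typeIAncientLiouville_of_line : TypeIAncientLiouville := by
  intro C u hu t ht x
  have hA : IsTypeIAncientMild C u := isTypeIAncientMild_iff.2 hu
  by_contra hx
  -- Step 0: the ledger, the slice pressure lemma, the far-shell sum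
  obtain ⟨K, hK⟩ := stub_farPastLedger C
  obtain ⟨c₀, hc₀, hHA⟩ := stub_slicePressureHA
  obtain ⟨cS, hcS0, hS⟩ := stub_fplFarShell
  -- Step 1: near/far structure of the window pressure at the centre `0` on `(-3, 0)`, for the whole class
  have hNF : ∀ w : ℝ → EuclideanSpace ℝ (Fin 3) → EuclideanSpace ℝ (Fin 3), IsTypeIAncientMild C w →
      ∃ p : ℝ → EuclideanSpace ℝ (Fin 3) → ℝ, IsClassicalNSSolutionOn (Ioo (-3) 0) 1 0 w p ∧
        ∀ τ ∈ Ioo (-3 : ℝ) 0, ∃ (c : ℝ) (p₁ p₂ : EuclideanSpace ℝ (Fin 3) → ℝ),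
          (∀ x ∈ ball (0 : EuclideanSpace ℝ (Fin 3)) 2, p τ x = c + p₁ x + p₂ x) ∧ MemLp p₁ 2 volume ∧
          ∫ x, p₁ x ^ 2 ≤ c₀ * (C ^ 2 / (-τ)) * ∫ x in ball (0 : EuclideanSpace ℝ (Fin 3)) 4, ‖w τ x‖ ^ 2 ∧
          ∀ x ∈ ball (0 : EuclideanSpace ℝ (Fin 3)) 2, DifferentiableAt ℝ p₂ x ∧
            ‖fderiv ℝ p₂ x‖ ≤ c₀ * ∫ y in (ball (0 : EuclideanSpace ℝ (Fin 3)) 3)ᶜ,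
              ‖w τ y‖ ^ 2 / ‖y - (0 : EuclideanSpace ℝ (Fin 3))‖ ^ 4 := by
    intro w hw
    obtain ⟨p, hp, h⟩ := nearFar_window_of_parts hc₀ stub_fplPressureGradientBound hHA stub_fplPinning
      stub_fplMeanDisplacement hw (t₀ := (-3 : ℝ)) (by norm_num)
    exact ⟨p, hp, fun τ hτ => h τ hτ 0⟩
  -- Step 2: the pressure package and the cubic bound: `A_C ∩ {ledger K} ⊂ 𝒦`
  obtain ⟨D₀, hPress⟩ := pressurePackage_of_nearFar (K := K) hc₀ hcS0 (hS stub_fplCovering) hNF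
  have hcubic : ∀ w : ℝ → EuclideanSpace ℝ (Fin 3) → EuclideanSpace ℝ (Fin 3), IsTypeIAncientMild C w →
      (∀ t < 0, ∀ (x₀ : EuclideanSpace ℝ (Fin 3)) (R : ℝ), 0 < R →
        ∫ x in ball x₀ R, ‖w t x‖ ^ 2 ≤ K * R) →
      ∫⁻ z in parabolicCylinder 1 (0 : ℝ × EuclideanSpace ℝ (Fin 3)), ‖w z.1 z.2‖ₑ ^ (3 : ℕ) ≤
        ENNReal.ofReal (2 * C * K) := by
    intro w hw hKw
    have key := lintegral_parabolicCylinder_le hw hKw (z := (0 : ℝ × EuclideanSpace ℝ (Fin 3))) le_rfl one_pos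
    simpa using key
  -- Step 3: blow-down at `(t, x)`, where `u ≠ 0`
  obtain ⟨t₁, x₁, c, U, W, ht₁, hcpos, hctop, hW, hpt, hlu, hsing, hUW⟩ :=
    stub_blowDownDriver C K D₀ hcubic hPress u hA (hK u hA) t x ht hx
  -- Step 4: the smooth blow-down limit is self-similar (the bet), hence zero (vertex leaf)
  have hss := stub_blowDownLimitSelfSimilar C K u hA (hK u hA) t₁ x₁ ht₁ c hcpos hctop W hW hpt hlu
  have hW0 : ∀ s < 0, ∀ y, W s y = 0 := selfSimilar_vanishes hW hss
  -- Step 5: so the singular limit vanishes a.e. on `Q(0, 1/2)`: contradiction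
  have hQm : MeasurableSet (parabolicCylinder (1 / 2) (0 : ℝ × EuclideanSpace ℝ (Fin 3))) :=
    (isOpen_parabolicCylinder _ _).measurableSet
  have hU0 : uncurry U =ᵐ[volume.restrict (parabolicCylinder (1 / 2) (0 : ℝ × EuclideanSpace ℝ (Fin 3)))] 0 := by
    filter_upwards [hUW, ae_restrict_mem hQm] with z hz hzQ
    rw [hz]
    obtain ⟨s, y⟩ := z
    rw [mem_parabolicCylinder] at hzQ
    have hs : s < 0 := by simpa using hzQ.1.2
    simp [hW0 s hs y]
  have h := hsing (1 / 2) (by norm_num)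
  rw [eLpNorm_congr_ae hU0, eLpNorm_zero] at h
  exact ENNReal.zero_ne_top h

/-- **The skeleton concludes the crux BY NAME**: `ForcedSymmetry` (route `SymmetryModuliCount`,
stmt-NavierStokesRegularity-4052) from the four registered stubs — `A_C = {0}` by the blow-down line, and the zero
field is symmetric. -/
theorem ForcedSymmetry_of : ForcedSymmetry := by
  intro C u hu
  exact simSymmetry_of_vanishes (typeIAncientLiouville_of_line C u hu)

end Summit.NavierStokesRegularity.NavierStokesRegularity.Cruxes.ForcedSymmetry.BlowDownCensus

end
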